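import Summits.PneNP.PneNP.Theorems.OneSliceConstantBandSliceLemma23
import Summits.PneNP.PneNP.Theorems.OneSliceConstantBandTransferStep
import Summits.PneNP.PneNP.Theorems.OneSliceConstantBandAdvSparseGlue

/-!
# Route OneSlice, crux `ConstantBand` (stmt-PneNP-2834), line `flat-prior-relative-minterms`:
# the crux from the engine in advantage form — `AdvSparse → ConstantBand`

The line reduces the crux `Summit.PneNP.PneNP.Theses.OneSlice.ConstantBand` to one open engine. In its ADVANTAGE
form `AdvSparse` ("for every `c` there are `k ≥ 3`, `ρ < 1/2`, `w₁` such that for all `w ≥ w₁`, eventually, every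
size-`n^c` monotone circuit has planted-`k`-clique detection advantage `≤ ρ·#lower` summed over the critical lower
band") the reduction uses only LANDED theorems: slice Lemma 23 (`stub_sliceLemma23`), the transfer
(`stub_transferStep : SliceLemma23 → BandPair → ConstantBandSchedule`) and the glue
`fprm_bandPair_of_advSparse : AdvSparse → BandPair`; no contiguity, no flat prior. This file records the resulting
CONDITIONAL theorem `fprm_constantBand_of_advSparse : AdvSparse → ConstantBand` (D-0014: the hypothesis is an open
statement of the line — an FPT average-case planted-clique distinguisher lower bound for monotone circuits at the
appearance threshold — not a Literature fact; the theorem closes nothing by itself and becomes the one-line closing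
step once the engine is proved). The minterm-form companion `RelMintermSparse → ConstantBand` (through all four
landed stubs) follows in `OneSliceConstantBandOfEngine.lean`.
-/

set_option linter.dupNamespace false

namespace Summit.PneNP.PneNP.Cruxes.ConstantBand.FlatPriorRelativeMinterms

open Summit.PneNP.PneNP.Theses.OneSlice (ConstantBand)

/-- **The crux from the engine (advantage form).** `AdvSparse → ConstantBand`, through `stub_transferStep`,
`stub_sliceLemma23` and `fprm_bandPair_of_advSparse` (all tree theorems). CONDITIONAL on the open engine
`AdvSparse`. -/
theorem fprm_constantBand_of_advSparse : AdvSparse → ConstantBand :=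
  fun hA => constantBand_iff.2 (stub_transferStep stub_sliceLemma23 (fprm_bandPair_of_advSparse hA))

end Summit.PneNP.PneNP.Cruxes.ConstantBand.FlatPriorRelativeMinterms
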